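import Literature.Combinatorics.Sahi2008.Chains
import Literature.Combinatorics.Sahi2008.Multilinear
import Summits.CriticalPhenomena.PercolationContinuityZ3.Theorems.PercNearOneGluingNoHeavyLowerTailSahiAbsorbedHeadBlocks

/-!
# An INDEPENDENT member factors out: `E_{n+2}(g, f) = n · E[g] · E_{n+1}(f)` — every weight of mass one

Support file (lane `prim-masterthm-p3`, generation 18; `--supports stmt-CriticalPhenomena-4575`).  Pure proofs, no definitions,
no `sorry`, standard axioms.

By the head block expansion (`SahiAbsorbed.sahiE_cons_eq_sum_powerset`) `E_{n+1}(g, f)` depends on the head `g` only through the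
moments `E[g · Π_{j∈S} f_j]` (`sahiE_cons_eq_of_head_moments`).  If the head is INDEPENDENT of the tail in the sense that these moments
factor (`E[g·Π_S f] = E[g]·E[Π_S f]`), the head may be replaced by the constant `E[g]`, and Sahi's branching identity
(`sahiE_cons_of_absorbing`) gives
  **`sahiE_cons_eq_of_indep_head`: `E_{n+2}(g, f_0, …, f_n) = n · E[g] · E_{n+1}(f)`** (weight of mass one),
so Sahi positivity at order `n+2` for families with an independent member follows from order `n+1` (`sahiE_cons_nonneg_of_indep_head`);
iterating gives the zero locus of `…SahiAbsorbedIndependent`.  For product measures: a member measurable with respect to coordinates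
not used by the others factors out. [this work]
-/

namespace Summit.CriticalPhenomena.PercolationContinuityZ3.Theorems

open Finset Function
open Literature.Combinatorics.Sahi2008 Literature.Combinatorics.Sahi2008.CycleForm

namespace SahiAbsorbed

section IndependentHead

variable {α : Type*} [Fintype α] (μ : α → ℝ) {n : ℕ}

/-- **`E_{n+1}(g, f)` depends on the head only through the moments `E[g · Π_S f]`.** [this work] -/
theorem sahiE_cons_eq_of_head_moments (g g' : α → ℝ) (f : Fin n → α → ℝ)
    (h : ∀ S : Finset (Fin n), ex μ (fun x => g x * ∏ j ∈ S, f j x) = ex μ (fun x => g' x * ∏ j ∈ S, f j x)) :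
    sahiE μ (n + 1) (Fin.cons g f) = sahiE μ (n + 1) (Fin.cons g' f) := by
  classical
  rw [sahiE_cons_eq_sum_powerset, sahiE_cons_eq_sum_powerset]
  exact sum_congr rfl fun S _ => by rw [h S]

/-- **AN INDEPENDENT HEAD FACTORS OUT**: if `E[g · Π_{j∈S} f_j] = E[g] · E[Π_{j∈S} f_j]` for every `S` (weight of mass one), then
`E_{n+2}(g, f_0, …, f_n) = n · E[g] · E_{n+1}(f)`. [this work] -/
theorem sahiE_cons_eq_of_indep_head (hμ : ∑ x, μ x = 1) (g : α → ℝ) (f : Fin (n + 1) → α → ℝ)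
    (hind : ∀ S : Finset (Fin (n + 1)), ex μ (fun x => g x * ∏ j ∈ S, f j x) = ex μ g * ex μ (fun x => ∏ j ∈ S, f j x)) :
    sahiE μ (n + 2) (Fin.cons g f) = (n : ℝ) * ex μ g * sahiE μ (n + 1) f := by
  -- replace the head by the constant `E[g]`
  have hmom : ∀ S : Finset (Fin (n + 1)),
      ex μ (fun x => g x * ∏ j ∈ S, f j x) = ex μ (fun x => (fun _ => ex μ g) x * ∏ j ∈ S, f j x) := by
    intro S
    rw [hind S, ex_def, ex_def, mul_sum]
    exact sum_congr rfl fun x _ => by ring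
  rw [sahiE_cons_eq_of_head_moments μ g (fun _ => ex μ g) f hmom]
  -- homogeneity in the head and Sahi's branching identity
  have hsmul : (Fin.cons (fun _ : α => ex μ g) f : Fin (n + 2) → α → ℝ) =
      update (Fin.cons (fun _ : α => (1 : ℝ)) f) 0 ((ex μ g) • fun _ : α => (1 : ℝ)) := by
    rw [Fin.update_cons_zero]
    congr 1
    funext x
    simp
  rw [hsmul, sahiE_update_smul, Fin.update_cons_zero]
  have hbr := sahiE_cons_of_absorbing μ n (fun _ => (1 : ℝ)) f (fun i => by funext x; simp)
  have hex : ex μ (fun _ : α => (1 : ℝ)) = 1 := by rw [ex_def]; simp [hμ]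
  rw [hex, show ((n : ℝ) + 1 - 1) = n by ring] at hbr
  rw [show (Fin.cons (fun _ : α => (1 : ℝ)) f : Fin (n + 2) → α → ℝ) = Matrix.vecCons (fun _ => (1 : ℝ)) f from rfl, hbr]
  ring

/-- **Sahi positivity with an independent member follows from the lower order**: `E[g] ≥ 0`, `E_{n+1}(f) ≥ 0` ⟹ `E_{n+2}(g, f) ≥ 0`.
[this work] -/
theorem sahiE_cons_nonneg_of_indep_head (hμ : ∑ x, μ x = 1) (g : α → ℝ) (f : Fin (n + 1) → α → ℝ)
    (hind : ∀ S : Finset (Fin (n + 1)), ex μ (fun x => g x * ∏ j ∈ S, f j x) = ex μ g * ex μ (fun x => ∏ j ∈ S, f j x))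
    (hg : 0 ≤ ex μ g) (hf : 0 ≤ sahiE μ (n + 1) f) : 0 ≤ sahiE μ (n + 2) (Fin.cons g f) := by
  rw [sahiE_cons_eq_of_indep_head μ hμ g f hind]
  exact mul_nonneg (mul_nonneg (Nat.cast_nonneg _) hg) hf

end IndependentHead

end SahiAbsorbed

end Summit.CriticalPhenomena.PercolationContinuityZ3.Theorems
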